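import Mathlib
import Literature.RingTheory.MvPowerSeries.CoordinateDivision
import Summits.ResolutionOfSingularities.ResolutionOfSingularities.Theorems.WeightedInvariantLocalWeightedDropNCResSettingStrict
import Summits.ResolutionOfSingularities.ResolutionOfSingularities.Theorems.WeightedInvariantLocalWeightedDropSpaceCountGameInvariance
import Summits.ResolutionOfSingularities.ResolutionOfSingularities.Theorems.WeightedInvariantLocalWeightedDropNCOrderGrowth

/-!
# `LocalWeightedDrop`, the NC count game — TOT2-LINE piece S-SET (3/4): **THROUGH-GOING BOUNDARY LETTERS DO NOT DIVIDE THE STRICT TRANSFORM**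

[OURS · L1 W4.3 · chain w43, engine crux `LocalWeightedDrop` stmt-ResolutionOfSingularities-8899; sub-line under the v32 registered stub
`stub_spaceNCRankDrop`, design memo `L/res-L1-w43-lead-1/g4/TOT2-LINE.md` v1 §2 (A3)/(S1), piece S-SET = res-L1-w43-stub-1; objects of
`…NCResSettingDefs` (p528587), tools of `…NCResSettingStrict`.  Elementary substitution algebra on `k⟦x⟧`; nothing here is a statement of any
manuscript.]

THE ARGUMENT (why boundary = coordinate letters makes (A3) elementary): a through-going boundary component `x_{l'} = 0` (`c_{l'} = 0`) becomes
the coordinate `y'_{l''}`, `l'' = predAbove i l'.succ ≠ 0`, of the new position; KILLING `y'_{l''}` after the sliced chart equals the sliced chart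
after KILLING `x_{l'}` (`subst_kill_slice_subst_chart`, checked letter by letter); the sliced chart is injective (`eq_zero_of_slice_subst_chart_eq_zero`,
by res-L0's `TupleDropAssembly.slice_ne_zero`); and killing a letter detects divisibility by it (`X_dvd_of_subst_kill_eq_zero`, by the tree's
coordinate division `Literature.RingTheory.MvPowerSeries.exists_eq_X_mul_add`).  Hence `y'_{l''} ∣ strict transform ⇒ x_{l'} ∣ f∘Φ ⇒ x_l ∣ f`
(back along the inverse coordinate change, `Φ_l = u · x_{l'}`): `Decoration.not_X_newLetter_dvd_strict`.
-/

set_option linter.dupNamespace false -- mandated namespace of this single-conjunct summit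

noncomputable section

namespace Summit.ResolutionOfSingularities.ResolutionOfSingularities.Theorems

namespace TameFourTupleDrop

open MvPowerSeries Literature.AlgebraicGeometry.Resolution

variable {k : Type} [Field k] {m : ℕ}

/-! ## Through-going boundary letters do not divide the sliced strict transform -/

section Letters

variable {i : Fin (m + 1)}

/-- The new letter of a through-going boundary component is not the exceptional letter. -/
theorem predAbove_succ_ne_zero {l' : Fin (m + 1)} (hl' : l' ≠ i) : Fin.predAbove i (Fin.succ l') ≠ 0 := by
  intro h
  have h1 : i.succ.succAbove (i.predAbove l'.succ) = l'.succ :=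
    Fin.succ_succAbove_predAbove (fun h' => hl' (Fin.succ_injective _ h'))
  rw [h, Fin.succAbove_ne_zero_zero (Fin.succ_ne_zero i)] at h1
  exact Fin.succ_ne_zero l' h1.symm

/-- The new letters of distinct through-going boundary components are distinct. -/
theorem predAbove_succ_injective {l₁ l₂ : Fin (m + 1)} (h₁ : l₁ ≠ i) (h₂ : l₂ ≠ i)
    (h : Fin.predAbove i (Fin.succ l₁) = Fin.predAbove i (Fin.succ l₂)) : l₁ = l₂ := by
  have e₁ : i.succ.succAbove (i.predAbove l₁.succ) = l₁.succ :=
    Fin.succ_succAbove_predAbove (fun h' => h₁ (Fin.succ_injective _ h'))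
  have e₂ : i.succ.succAbove (i.predAbove l₂.succ) = l₂.succ :=
    Fin.succ_succAbove_predAbove (fun h' => h₂ (Fin.succ_injective _ h'))
  rw [h, e₂] at e₁
  exact (Fin.succ_injective _ e₁).symm

/-- The family KILLING one letter (`X l ↦ 0`, the other letters fixed). -/
theorem hasSubst_kill {n : ℕ} (l : Fin n) :
    HasSubst (fun j : Fin n => if j = l then (0 : MvPowerSeries (Fin n) k) else X j) :=
  hasSubst_of_constantCoeff_zero fun j => by split_ifs <;> simp [constantCoeff_X]

/-- Killing a letter fixes every series whose support avoids that letter. -/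
theorem subst_kill_eq_self_of_support {n : ℕ} (l : Fin n) (r : MvPowerSeries (Fin n) k)
    (hr : ∀ e : Fin n →₀ ℕ, coeff e r ≠ 0 → e l = 0) :
    subst (fun j : Fin n => if j = l then (0 : MvPowerSeries (Fin n) k) else X j) r = r := by
  classical
  have hprod : ∀ d : Fin n →₀ ℕ, coeff d r ≠ 0 →
      (d.prod fun s e => (if s = l then (0 : MvPowerSeries (Fin n) k) else X s) ^ e) = monomial d 1 := by
    intro d hd
    rw [MvPowerSeries.monomial_one_eq]
    refine Finsupp.prod_congr fun s hs => ?_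
    by_cases hsl : s = l
    · exact absurd (hr d hd) (by rw [← hsl]; exact Finsupp.mem_support_iff.mp hs)
    · rw [if_neg hsl]
  ext e
  rw [coeff_subst (hasSubst_kill l), finsum_eq_single _ e]
  · by_cases he : coeff e r = 0
    · rw [he, zero_smul]
    · rw [hprod e he, coeff_monomial, if_pos rfl, smul_eq_mul, mul_one]
  · intro d hde
    by_cases hd : coeff d r = 0
    · rw [hd, zero_smul]
    · rw [hprod d hd, coeff_monomial, if_neg hde.symm, smul_zero]

/-- KILLING A LETTER DETECTS DIVISIBILITY by that letter: `F|_{x_l = 0} = 0 ⇒ X l ∣ F`. -/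
theorem X_dvd_of_subst_kill_eq_zero {n : ℕ} (l : Fin n) (F : MvPowerSeries (Fin n) k)
    (h : subst (fun j : Fin n => if j = l then (0 : MvPowerSeries (Fin n) k) else X j) F = 0) : X l ∣ F := by
  obtain ⟨q, r, -, hr, hF⟩ := Literature.RingTheory.MvPowerSeries.exists_eq_X_mul_add l F
  have hrsupp : ∀ e : Fin n →₀ ℕ, coeff e r ≠ 0 → e l = 0 := by
    intro e he
    by_contra hne
    exact he (by rw [hr e, if_neg hne])
  have hkr := subst_kill_eq_self_of_support l r hrsupp
  have hk : HasSubst (fun j : Fin n => if j = l then (0 : MvPowerSeries (Fin n) k) else X j) := hasSubst_kill l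
  have h' : subst (fun j : Fin n => if j = l then (0 : MvPowerSeries (Fin n) k) else X j) F =
      subst (fun j : Fin n => if j = l then (0 : MvPowerSeries (Fin n) k) else X j) r := by
    rw [← hF, ← coe_substAlgHom hk, map_add, map_mul, coe_substAlgHom, subst_X hk, if_pos rfl, zero_mul, zero_add]
  have h0 : r = 0 :=
    calc r = _ := hkr.symm
      _ = _ := h'.symm
      _ = 0 := h
  exact ⟨q, by rw [← hF, h0, add_zero]⟩

/-- THE CHART IS INJECTIVE UP TO THE SLICE: if the sliced chart transform of `H` vanishes then `H = 0` (weights `≤ 1`, chart convention,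
live slot). -/
theorem eq_zero_of_slice_subst_chart_eq_zero {w : Fin (m + 1) → ℕ} {c : Fin (m + 1) → k} (hc : ∀ l, w l = 0 → c l = 0)
    (hw : ∀ l, w l ≤ 1) (hci : c i ≠ 0) {H : MvPowerSeries (Fin (m + 1)) k}
    (h : TupleGame.slice i (subst (CobordantChart.chart w c) H) = 0) : H = 0 := by
  by_contra hH
  obtain ⟨a, G', hfac, hG'⟩ := CobordantVertexChart.exists_eq_X_pow_mul_not_dvd (CobordantChart.subst_chart_ne_zero w c hc hH)
  have hsl := TupleDropAssembly.slice_ne_zero H w c hc hw a G' hfac hG' i hci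
  rw [hfac, NCTransport.slice_X_zero_pow_mul'] at h
  exact hsl ((mul_eq_zero.mp h).resolve_left (pow_ne_zero _ (MvPowerSeries.prime_X' k (0 : Fin (m + 1))).ne_zero))

/-- The slice of a chart component: `(s^{w_j}(c_j + y_j))|_{y_i = 0} = s^{w_j} · (c_j + [j ≠ i] y'_j)`. -/
theorem slice_chart (w : Fin (m + 1) → ℕ) (c : Fin (m + 1) → k) (j : Fin (m + 1)) :
    TupleGame.slice i (CobordantChart.chart w c j) =
      X 0 ^ (w j) * (C (c j) + if j = i then 0 else X (Fin.predAbove i (Fin.succ j))) := by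
  have hs := CobordantChartPlaneSlice.hasSubst_slice (R := k) i
  unfold TupleGame.slice
  rw [CobordantChart.chart_apply, ← coe_substAlgHom hs, map_mul, map_pow, map_add, coe_substAlgHom, subst_X hs, subst_X hs,
    subst_C]
  have h0 : ((0 : Fin (m + 1 + 1)) = i.succ) = False := propext ⟨fun h => Fin.succ_ne_zero i h.symm, False.elim⟩
  simp only [h0, if_false, Fin.predAbove_right_zero]
  congr 2
  by_cases hj : j = i
  · rw [if_pos (by rw [hj]), if_pos hj]
  · rw [if_neg (fun h => hj (Fin.succ_injective _ h)), if_neg hj]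

/-- KILLING THE NEW LETTER OF A THROUGH-GOING COMPONENT `x_{l'}` COMMUTES WITH THE SLICED CHART, becoming the kill of `x_{l'}` upstairs:
for `c_{l'} = 0`, `l' ≠ i`: `(slice ∘ chart ∘ H)|_{y'_{l''} = 0} = slice (chart (H|_{x_{l'} = 0}))` with `l'' = predAbove i l'.succ`. -/
theorem subst_kill_slice_subst_chart {w : Fin (m + 1) → ℕ} {c : Fin (m + 1) → k} (hc : ∀ l, w l = 0 → c l = 0)
    {l' : Fin (m + 1)} (hl' : l' ≠ i) (hcl' : c l' = 0) (H : MvPowerSeries (Fin (m + 1)) k) :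
    subst (fun j : Fin (m + 1) => if j = Fin.predAbove i (Fin.succ l') then (0 : MvPowerSeries (Fin (m + 1)) k) else X j)
        (TupleGame.slice i (subst (CobordantChart.chart w c) H)) =
      TupleGame.slice i (subst (CobordantChart.chart w c)
        (subst (fun j : Fin (m + 1) => if j = l' then (0 : MvPowerSeries (Fin (m + 1)) k) else X j) H)) := by
  set l'' := Fin.predAbove i (Fin.succ l') with hl''
  have hσ := hasSubst_kill (k := k) l''
  have hκ := hasSubst_kill (k := k) l'
  have hch := CobordantChart.hasSubst_chart w c hc
  have hsl := CobordantChartPlaneSlice.hasSubst_slice (R := k) i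
  have hl''0 : l'' ≠ 0 := predAbove_succ_ne_zero hl'
  -- both sides are substitutions of `H`; compare them letter by letter
  unfold TupleGame.slice
  have hA : HasSubst (fun s : Fin (m + 1) => subst (fun t : Fin (m + 1 + 1) => if t = i.succ then (0 : MvPowerSeries (Fin (m + 1)) k)
      else X (Fin.predAbove i t)) (CobordantChart.chart w c s)) := by
    simpa only [coe_substAlgHom] using hch.comp hsl
  have hB : HasSubst (fun s : Fin (m + 1) => subst (CobordantChart.chart w c)
      ((fun j : Fin (m + 1) => if j = l' then (0 : MvPowerSeries (Fin (m + 1)) k) else X j) s)) := by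
    simpa only [coe_substAlgHom] using hκ.comp hch
  rw [subst_comp_subst_apply hch hsl, subst_comp_subst_apply hA hσ, subst_comp_subst_apply hκ hch,
    subst_comp_subst_apply hB hsl]
  congr 1
  funext j
  show subst (fun j : Fin (m + 1) => if j = l'' then (0 : MvPowerSeries (Fin (m + 1)) k) else X j)
      (subst (fun t : Fin (m + 1 + 1) => if t = i.succ then (0 : MvPowerSeries (Fin (m + 1)) k) else X (Fin.predAbove i t))
        (CobordantChart.chart w c j)) =
    subst (fun t : Fin (m + 1 + 1) => if t = i.succ then (0 : MvPowerSeries (Fin (m + 1)) k) else X (Fin.predAbove i t))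
      (subst (CobordantChart.chart w c) (if j = l' then (0 : MvPowerSeries (Fin (m + 1)) k) else X j))
  have hσ0 : subst (fun j : Fin (m + 1) => if j = l'' then (0 : MvPowerSeries (Fin (m + 1)) k) else X j)
      (X 0 : MvPowerSeries (Fin (m + 1)) k) = X 0 := by
    rw [subst_X hσ, if_neg hl''0.symm]
  have hslj : ∀ j' : Fin (m + 1), subst (fun t : Fin (m + 1 + 1) => if t = i.succ then (0 : MvPowerSeries (Fin (m + 1)) k)
      else X (Fin.predAbove i t)) (CobordantChart.chart w c j') =
      X 0 ^ (w j') * (C (c j') + if j' = i then 0 else X (Fin.predAbove i (Fin.succ j'))) := fun j' => slice_chart w c j'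
  rw [hslj j]
  by_cases hj : j = l'
  · -- the killed letter: both sides vanish
    rw [if_pos hj, ← coe_substAlgHom hch, map_zero, ← coe_substAlgHom hsl, map_zero, hj, if_neg hl', hcl', map_zero, zero_add,
      ← coe_substAlgHom hσ, map_mul, map_pow, coe_substAlgHom, hσ0, subst_X hσ, ← hl'', if_pos rfl, mul_zero]
  · rw [if_neg hj, subst_X hch, hslj j, ← coe_substAlgHom hσ, map_mul, map_pow, map_add, coe_substAlgHom, hσ0, subst_C]
    congr 2
    by_cases hji : j = i
    · rw [if_pos hji, ← coe_substAlgHom hσ, map_zero]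
    · rw [if_neg hji, subst_X hσ, if_neg]
      intro h
      exact hj (predAbove_succ_injective hji hl' h)

end Letters

/-! ## The conclusion for a decoration -/

/-- **(A3) FOR THE TRANSFORM, THROUGH-GOING LETTERS** (OURS · L1 W4.3, S-SET): if the boundary component `x_l` does not divide `f`, the
move straightens it (`Φ_l = u · x_{l'}`, `u(0) ≠ 0`) and it passes through the new point (`c_{l'} = 0`), then its new letter
`y'_{l''}`, `l'' = predAbove i l'.succ`, does not divide the sliced strict transform of `f` at the live slot `i`. -/
theorem Decoration.not_X_newLetter_dvd_strict {δ : Decoration k m} {Φ : Fin (m + 1) → MvPowerSeries (Fin (m + 1)) k}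
    {w : Fin (m + 1) → ℕ} {c : Fin (m + 1) → k} (hmv : IsCountMove Φ w) (hc : ∀ l, w l = 0 → c l = 0) (hf : δ.f ≠ 0)
    {i : Fin (m + 1)} (hci : c i ≠ 0) {l l' : Fin (m + 1)} (hXl : ¬ X l ∣ δ.f) {u : MvPowerSeries (Fin (m + 1)) k} (hu : constantCoeff u ≠ 0)
    (hΦl : Φ l = u * X l') (hcl' : c l' = 0) : ¬ X (Fin.predAbove i (Fin.succ l')) ∣ δ.strict Φ w c i := by
  have hl' : l' ≠ i := fun h => hci (h ▸ hcl')
  intro hdvd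
  have hσ := hasSubst_kill (k := k) (Fin.predAbove i (Fin.succ l'))
  obtain ⟨hfac, -⟩ := Decoration.fChart_eq (δ := δ) (c := c) hmv hc hf
  -- (1) killing the new letter annihilates the sliced chart transform of `f∘Φ`
  have hkill : subst (fun j : Fin (m + 1) => if j = Fin.predAbove i (Fin.succ l') then (0 : MvPowerSeries (Fin (m + 1)) k) else X j)
      (TupleGame.slice i (subst (CobordantChart.chart w c) (subst Φ δ.f))) = 0 := by
    obtain ⟨q, hq⟩ := hdvd
    have hq' : TupleGame.slice i (satPart (δ.fChart Φ w c)) = X (Fin.predAbove i (Fin.succ l')) * q := hq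
    rw [hfac, NCTransport.slice_X_zero_pow_mul', hq', ← coe_substAlgHom hσ, map_mul, map_mul, coe_substAlgHom, subst_X hσ, if_pos rfl,
      zero_mul, mul_zero]
  -- (2) commute the kill past the sliced chart and use injectivity: `(f∘Φ)|_{x_{l'} = 0} = 0`
  rw [subst_kill_slice_subst_chart hc hl' hcl'] at hkill
  have h3 := eq_zero_of_slice_subst_chart_eq_zero hc hmv.2.2.1 hci hkill
  -- (3) so `x_{l'} ∣ f∘Φ`
  obtain ⟨q, hq⟩ := X_dvd_of_subst_kill_eq_zero l' _ h3
  -- (4) back along the inverse coordinate change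
  obtain ⟨ψ, hψ0, hψΦ, -⟩ := FormalCoordChange.exists_comp_inverse hmv.1 hmv.2.1
  have hψs : HasSubst ψ := hasSubst_of_constantCoeff_zero hψ0
  have hΦs : HasSubst Φ := hasSubst_of_constantCoeff_zero hmv.1
  have hback : subst ψ (subst Φ δ.f) = δ.f := by
    have hfun : (fun s => subst ψ (Φ s)) = (X : Fin (m + 1) → MvPowerSeries (Fin (m + 1)) k) := funext hψΦ
    rw [subst_comp_subst_apply hΦs hψs, hfun]
    exact congrFun subst_self δ.f
  -- `x_l = (u∘ψ) · ψ_{l'}` with `u∘ψ` a unit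
  have hXl' : (X l : MvPowerSeries (Fin (m + 1)) k) = subst ψ u * ψ l' := by
    rw [← hψΦ l, hΦl, ← coe_substAlgHom hψs, map_mul, coe_substAlgHom, subst_X hψs]
  have hunit : IsUnit (subst ψ u) := by
    rw [isUnit_iff_constantCoeff, constantCoeff_subst_of_constantCoeff_zero ψ hψ0 u]
    exact Ne.isUnit hu
  obtain ⟨v, hv⟩ := hunit
  apply hXl
  refine ⟨↑v⁻¹ * subst ψ q, ?_⟩
  calc δ.f = subst ψ (subst Φ δ.f) := hback.symm
    _ = ψ l' * subst ψ q := by rw [hq, ← coe_substAlgHom hψs, map_mul, coe_substAlgHom, subst_X hψs]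
    _ = (↑v⁻¹ * X l) * subst ψ q := by rw [hXl', ← hv, ← mul_assoc, Units.inv_mul, one_mul]
    _ = X l * (↑v⁻¹ * subst ψ q) := by ring


end TameFourTupleDrop

end Summit.ResolutionOfSingularities.ResolutionOfSingularities.Theorems

end
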